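import Summits.ValiantsHypothesis.ValiantsHypothesis.Theorems.KPlusLogSqLawValuativeDoorSweep

/-!
# LINE `valuative_door` (crux `WeakLifting`, stmt-ValiantsHypothesis-19561) — DICTIONARY: THE WIDTH-TWO ROW BOUNDS THE NEWTON POLYGON OF
# `f·g + 1` (so a LINEAR unrestricted row `v(2,K) ≤ cK` would settle an open question of Koiran–Portier–Tavenas–Thomassé)

HONEST FRAMING.  Helper (cell `pub-symmetroid`, seat val-sym-lift-p1 g24, 2026-08-29; `--supports 19561 --as helper`).  A two-line
dictionary, kernel-checked so that the line can quote it: for `K` letters on a support `d` containing `0 = d l₀`, the SYMMETRIC width-two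
letters `S_l = !![p_l, δ_{l l₀}; δ_{l l₀}, −q_l]` have `det Σ_l X^{d_l} S_l = −(f g + 1)` with `f = Σ_l p_l X^{d_l}`, `g = Σ_l q_l X^{d_l}`
(`det_fgPencil`), and negation keeps the dominant exponents (landed `dominant_filter_neg`); hence (`valRow_two_fg_add_one_unfolded`) the
width-two valuative row at `(F, v)` — «every symmetric `2 × 2` pencil with `K` letters has `npEdges ≤ B`», the `(F, v)`-instance of the
skeleton's `ValRootLawAt 2 K B` — bounds `npEdges_v (f g + 1) ≤ B` for ALL `f, g ∈ F[X]` supported on `d`.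
WHY THIS IS RECORDED (prose, not kernel): over `F = k((Y))` with the `Y`-adic absolute value (characteristic zero, non-archimedean) the
`npEdges` of a polynomial in `X` with coefficients in `k[Y, Y⁻¹]` is the number of LOWER edges (outward normal with negative `Y`-component) of its
bivariate Newton polygon, and over `k((Y⁻¹))` the number of UPPER edges; a polygon has at most two further (vertical) edges.  So a law
`v(2, K) ≤ cK` for the UNRESTRICTED symmetric width-two row (the growth question left by g23: Sidon supports `3K − 4` exact ✓, `v(2,5) ≥ 13` ✓)
would give `#edges Newt(fg + 1) ≤ 2c(2t + 1) + 2 = O(t)` for all bivariate `f, g` with at most `t` monomials (common support `supp f ∪ supp g ∪ {0}`,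
`K ≤ 2t + 1`) — the question «what is the maximum number of edges of `Newt(fg + 1)`?  `O(t^{4/3})` is known, the true bound could be linear»
asked by Koiran–Portier–Tavenas–Thomassé (A τ-conjecture for Newton polygons, Found. Comput. Math. 2015, §5 and Appendix: «we do not know how
to prove a linear upper bound assuming only (i) [equal supports]», doi:10.1007/s10208-014-9216-x, arXiv:1308.2286), whose `O(t^{4/3})` is the
convexly-independent-subsets-of-Minkowski-sums bound of Eisenbrand–Pach–Rothvoß–Sopher (Electron. J. Combin. 15 (2008) N8, doi:10.37236/883;
tight as pure combinatorial geometry, Bílka et al. 2010, doi:10.37236/484).  READING FOR THE CELL: a LINEAR law for the unrestricted row is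
open-problem-hard; calibrate named sub-classes instead (companion `…ValuativeDoorProgressionFree`: off three-term progressions `≤ 4K − 3`).
No converse is claimed (the valuative row allows cancellations that `fg + 1` does not).  Nothing here is a stub of the line or closes anything;
no bearing on vW / vB, `TropicalB`, `MatrixDescartes` (18050) or VP ≠ VNP.  [elementary dictionary; the cited question is OPEN, not used]
-/

set_option linter.dupNamespace false
set_option autoImplicit false

namespace Summit.ValiantsHypothesis.ValiantsHypothesis.Theorems.KPlusLogSqLaw.ValDoor

open Polynomial Finset
open scoped BigOperators Classical

variable {F : Type*} [Field F]

/-- the `fg + 1` letters are symmetric. [bookkeeping] -/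
theorem fgLetter_isSymm {K : ℕ} (p q : Fin K → F) (l₀ l : Fin K) :
    (!![p l, if l = l₀ then (1 : F) else 0; if l = l₀ then (1 : F) else 0, -q l] : Matrix (Fin 2) (Fin 2) F).IsSymm := by
  rw [Matrix.IsSymm]
  ext i j
  fin_cases i <;> fin_cases j <;> rfl

/-- **`det Σ_l X^{d_l} S_l = −(f g + 1)`** for the letters `S_l = !![p_l, δ_{l l₀}; δ_{l l₀}, −q_l]` on a support with `d l₀ = 0`,
where `f = Σ_l p_l X^{d_l}` and `g = Σ_l q_l X^{d_l}`. [bookkeeping: `Matrix.det_fin_two`] -/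
theorem det_fgPencil {K : ℕ} (d : Fin K → ℕ) (l₀ : Fin K) (h0 : d l₀ = 0) (p q : Fin K → F) :
    Matrix.det (∑ l, ((X : F[X]) ^ d l) •
        (!![p l, if l = l₀ then (1 : F) else 0; if l = l₀ then (1 : F) else 0, -q l] : Matrix (Fin 2) (Fin 2) F).map (C : F →+* F[X]))
      = -((∑ l, C (p l) * (X : F[X]) ^ d l) * (∑ l, C (q l) * (X : F[X]) ^ d l) + 1) := by
  have hentry : ∀ i j : Fin 2, (∑ l, ((X : F[X]) ^ d l) •
      (!![p l, if l = l₀ then (1 : F) else 0; if l = l₀ then (1 : F) else 0, -q l] : Matrix (Fin 2) (Fin 2) F).map (C : F →+* F[X])) i j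
        = ∑ l, C ((!![p l, if l = l₀ then (1 : F) else 0; if l = l₀ then (1 : F) else 0, -q l] : Matrix (Fin 2) (Fin 2) F) i j)
            * X ^ d l := by
    intro i j
    rw [Matrix.sum_apply]
    refine Finset.sum_congr rfl fun l _ => ?_
    rw [Matrix.smul_apply, Matrix.map_apply, smul_eq_mul, mul_comm]
  rw [Matrix.det_fin_two, hentry, hentry, hentry, hentry]
  simp only [Matrix.of_apply, Matrix.cons_val', Matrix.cons_val_zero, Matrix.cons_val_one, Matrix.cons_val_fin_one,
    Matrix.empty_val']
  -- the off-diagonal entry is `X ^ (d l₀) = 1`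
  have hone : (∑ l, C (if l = l₀ then (1 : F) else 0) * (X : F[X]) ^ d l) = 1 := by
    rw [Finset.sum_eq_single l₀]
    · rw [if_pos rfl, map_one, one_mul, h0, pow_zero]
    · intro l _ hl
      rw [if_neg hl, map_zero, zero_mul]
    · intro h
      exact absurd (Finset.mem_univ l₀) h
  have hneg : (∑ l, C (-q l) * (X : F[X]) ^ d l) = -(∑ l, C (q l) * (X : F[X]) ^ d l) := by
    rw [← Finset.sum_neg_distrib]
    refine Finset.sum_congr rfl fun l _ => ?_
    rw [map_neg, neg_mul]
  rw [hone, hneg]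
  ring

/-- **THE WIDTH-TWO ROW BOUNDS THE NEWTON POLYGON OF `f g + 1`, UNFOLDED.**  At a field `F` with a non-archimedean absolute value `v`:
if every symmetric `2 × 2` lacunary pencil with `K` letters has at most `B` Newton edges (the `(F, v)`-instance of `ValRootLawAt 2 K B`,
raw predicate), then for every support `d : Fin K → ℕ` with `d l₀ = 0` and all coefficient vectors `p, q`, the polynomial
`(Σ_l p_l X^{d_l}) (Σ_l q_l X^{d_l}) + 1` has at most `B` Newton edges. [dictionary: `det_fgPencil` + `dominant_filter_neg`] -/
theorem valRow_two_fg_add_one_unfolded :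
    ∀ (F : Type) [Field F] (v : AbsoluteValue F ℝ), IsNonarchimedean v → ∀ (K B : ℕ),
      (∀ (d : Fin K → ℕ) (S : Fin K → Matrix (Fin 2) (Fin 2) F), (∀ l, (S l).IsSymm) →
        ((Matrix.det (∑ l, ((X : F[X]) ^ d l) • (S l).map (C : F →+* F[X]))).support.filter fun E =>
            ∃ r : ℝ, 0 < r ∧ ∀ E' ∈ (Matrix.det (∑ l, ((X : F[X]) ^ d l) • (S l).map (C : F →+* F[X]))).support, E' ≠ E →
              v ((Matrix.det (∑ l, ((X : F[X]) ^ d l) • (S l).map (C : F →+* F[X]))).coeff E') * r ^ E'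
                < v ((Matrix.det (∑ l, ((X : F[X]) ^ d l) • (S l).map (C : F →+* F[X]))).coeff E) * r ^ E).card - 1 ≤ B) →
      ∀ (d : Fin K → ℕ) (l₀ : Fin K), d l₀ = 0 → ∀ (p q : Fin K → F),
        (((∑ l, C (p l) * (X : F[X]) ^ d l) * (∑ l, C (q l) * (X : F[X]) ^ d l) + 1).support.filter fun E =>
            ∃ r : ℝ, 0 < r ∧ ∀ E' ∈ ((∑ l, C (p l) * (X : F[X]) ^ d l) * (∑ l, C (q l) * (X : F[X]) ^ d l) + 1).support, E' ≠ E →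
              v (((∑ l, C (p l) * (X : F[X]) ^ d l) * (∑ l, C (q l) * (X : F[X]) ^ d l) + 1).coeff E') * r ^ E'
                < v (((∑ l, C (p l) * (X : F[X]) ^ d l) * (∑ l, C (q l) * (X : F[X]) ^ d l) + 1).coeff E) * r ^ E).card - 1
          ≤ B := by
  intro F _ v _ K B hrow d l₀ h0 p q
  have h := hrow d (fun l => !![p l, if l = l₀ then (1 : F) else 0; if l = l₀ then (1 : F) else 0, -q l])
    (fun l => fgLetter_isSymm p q l₀ l)
  rw [det_fgPencil d l₀ h0 p q, dominant_filter_neg] at h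
  exact h

end Summit.ValiantsHypothesis.ValiantsHypothesis.Theorems.KPlusLogSqLaw.ValDoor
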